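import Summits.QuantumFields.YangMills.Theorems.BalabanUVNodesN15CurvedCubeTransplant
import Summits.QuantumFields.YangMills.Theorems.BalabanUVNodesN15TwoSpacingGluingCommutator
import HarnessLib

/-!
# Route «BalabanUVNodes» (cluster K4 «SpineRates»), Track-A DAG node N15 = NE2, BACKGROUND LAYER — A LAPLACIAN-TYPE OPERATOR PAST A TRANSPLANTED CUBE OPERATOR BEHIND A CUT:
# the shifts, `∇*∇` and `Δ_a = Σ_μ ∇_μ*∇_μ + W` of the GLOBAL lattice agree with the transplanted CUBE ones behind any multiplication `M_h` with `h` vanishing on the one-step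
# layer of the window, and THE CUBE's LOCALIZED-INVERSE PROPERTY `M_χ′ Δ_□ G_□ = M_χ′` TRANSPLANTS: `M_h ∘ Δ_glob ∘ (ε G_□ ρ) = M_h` (EXACT) — the `hloc` of the gluing, read on
# the global lattice

Cell `pub-ymgap`, WIDTH SEAT `pub-ymgap-dag-n15-w2` (director-ym №197 ∕ HUMAN RULING D-0149), generation 3, file 3 (second half of dag-n15-w3 g3's located piece (c),
pub-ymgap INBOX l.28190 ∕ l.28884: «the knit needs exactly your boundary operator as the locality DEFECT of a transplanted cube — dag-n15-a's `neumannCubeG` lives on the cube's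
doubled torus (exact hloc there), so on the global lattice `M_hΔ_glob(transplant G) = M_h + E`»).  `bears_on: R4∕N15 · K3⁷ SpineGivenEndpointR13SepCoPH (stmt-QuantumFields-20544)`.
Filed `--kind proof --supports stmt-QuantumFields-20544 --as helper` — COUNT-NEUTRAL; theorems only (0 `def`, 0 `sorry`).  Imports BY NAME dag-n15-w3 g2's file 11
`…N15CurvedCubeTransplant` (`transplant`, `extendOp`, `restrictOp`, `restrictOp_apply_of_injOn` of lit `B6Prop26ReachTransplant`) and dag-n15-c g11's FILE 46
`…N15TwoSpacingGluingCommutator` (`Gluing.lapDir`, `Gluing.lapOp`; through it `BackgroundLayer.fgrad ∕ fgradAdj ∕ bgrad`, lit `B6Prop26Gluing.mulOp`); nothing re-declared.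

WHY.  This seat's file 2 (`…N15CurvedCubeTransplantGradient`) gave `∇_glob ∘ (εTρ) = ε(∇_□T)ρ + boundary` with the boundary operator on the one-step layer and its CUT editions.
The gluing's per-cube input at a live background is a LOCALIZED-INVERSE identity `hloc : M_χ ∘ Δ ∘ G_□ = M_χ` ([Balaban1984PropagatorsII] (2.90)–(2.93) p. 239: `G_□` inverts the
cube operator where `h_□` lives; dag-n15-a's FILE 45 ∕ N-IIIa for `neumannCubeG` on the cube's doubled torus, dag-n15-w3 g3's `mulOp_comp_covLapM_add_comp_dressed` at live `U`).  When the
cube operator is typed on the cube's OWN lattice and read on the global lattice through file 11's transplant, the consumer needs `hloc` with the GLOBAL `Δ`.  Since `Δ_a = Σ_μ ∇_μ*∇_μ + W`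
is one-step local, behind a cut `M_h` supported one step inside the window (every partition function `h_□`, (2.36) p. 229) the global and the transplanted cube Laplacians AGREE, and the
cube's `hloc` (with `h ≤` the cube's `χ′` read through the chart) gives `M_h ∘ Δ_glob ∘ (εG_□ρ) = M_h` EXACTLY — no boundary letter, no defect slot.  THIS FILE types that: the
atomic cut-shift identity, the `∇*∇` and `Δ_a` editions (zeroth-order parts compatible through the chart), the sandwich `M_h ∘ ε S ρ = M_h` from `M_χ′ S = M_χ′`, and the transplanted `hloc`.

WHAT: §1 `mulOp_comp_pull_comp_transplant` (atomic: `M_h ∘ S_E ∘ εTρ = M_h ∘ ε(S_{E′}T)ρ` for `h = 0` on `{x ∉ W} ∪ {Ex ∉ W}`), `mulOp_comp_transplant_comm` (`M_h ∘ εTρ = ε(M_{h′}T)ρ`-type: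
a GLOBAL multiplication past the transplant is the transplant of the CUBE multiplication by `a′` when `a = a′ ∘ e` on `W`), ★★ `mulOp_comp_lapDir_comp_transplant` (`M_h ∘ ∇*_E∇_E ∘ εTρ =
M_h ∘ ε(∇*_{E′}∇_{E′}T)ρ` for `h = 0` on `{x ∉ W} ∪ {Ex ∉ W} ∪ {E⁻¹x ∉ W}`), ★★ `comp_fsum_comp`, `transplant_add ∕ _fsum`, ★★ `mulOp_comp_lapOp_comp_transplant` (`Δ_a = Σ_μ ∇_μ*∇_μ + W_glob` vs the cube's `Σ_μ ∇′_μ*∇′_μ + W_□`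
under `M_h ∘ W_glob ∘ εTρ = M_h ∘ ε(W_□T)ρ` — e.g. `W = M_a`, `W_□ = M_{a′}`, `a = a′∘e` on `W`, by `mulOp_comp_transplant_comm`); §2 ★★ `mulOp_comp_transplant_eq_mulOp_of_cut`
(`M_χ′ ∘ S = M_χ′` on the cube, `h = 0` off `W`, `h x ≠ 0 → χ′(e x) = 1`, chart injective on `W` ⟹ `M_h ∘ εSρ = M_h`), ★★★ `mulOp_comp_lapOp_comp_transplant_of_hloc` (THE
TRANSPLANTED `hloc`: `M_χ′ ∘ Δ_□ ∘ G = M_χ′` on the cube ⟹ `M_h ∘ Δ_glob ∘ (εGρ) = M_h` on the global lattice, for `h` vanishing on the one-step layer in every direction and inside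
`{χ′∘e = 1}`), ★★ `mulOp_comp_lapOp_comp_transplant_of_hloc_defect` (the same with a cube-side defect slot `M_χ′ ∘ Δ_□ ∘ G = M_χ′ + D` ⟹ `M_h ∘ Δ_glob ∘ (εGρ) = M_h + M_h ∘ εDρ` —
dag-n15-w3's `…_of_defect` shape, the nonlocal tail's home), ★ `hasMaj_mulOp_comp_transplant` (the slot's global letter `M_h∘εDρ ≤ 1_W(y)1_W(y′)K` from the cube letter of `D`).

HONEST FRAMING ∕ LIMITS.  Finite-lattice support bookkeeping (pointwise case analysis) over the lit's transplant; ONE grid; the window∕chart geometry (injective chart, shift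
compatibility `e(E_μx) = E′_μ(ex)` inside the window), the cut's support and the cube's `hloc` are DISPLAYED hypotheses; the partition of unity, the resummation and every estimate
are dag-n15-c's ∕ dag-n15-a's ∕ dag-n15-w3's files; nothing of [B6]∕[B9] asserted ((2.90)–(2.93) p. 239, (2.36) p. 229, (2.133) p. 247 cited as SHAPES).  NE2⁺ NOT PRINTED ∕ NOT
proved for d = 4; N15 NOT discharged; K3⁷ OPEN; counts UNMOVED (typed 28∕28 · discharged 5∕27, A 5∕28); one finite 𝕋⁴ at fixed ε — NOT infinite volume, NOT OS on ℝ⁴, NOT a mass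
gap, NOT Clay; R4 closes the conditional finite-𝕋⁴ rung `BalabanLadder.UV` only.  Restate-immune (no Theses import).
-/

set_option autoImplicit false

noncomputable section
open scoped BigOperators
open Finset

namespace Summit.QuantumFields.YangMills.BalabanUVNodes.N15.CurvedSpecies

open Literature.MathematicalPhysics.QuantumFieldTheory.Balaban1983to89
open Literature.MathematicalPhysics.QuantumFieldTheory.Balaban1983to89.B11SectG (BlockNorm HasMaj)
open Literature.MathematicalPhysics.QuantumFieldTheory.Balaban1983to89.B11AxialTransport190 (abs_le_loc_ofBlocks loc_ofBlocks_le)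
open Literature.MathematicalPhysics.QuantumFieldTheory.Balaban1983to89.B6Prop26ReachTransplant (restrictOp extendOp transplant transplant_apply restrictOp_apply_of_injOn)
open Literature.MathematicalPhysics.QuantumFieldTheory.Balaban1983to89.B6Prop26Gluing (mulOp mulOp_apply)
open Literature.MathematicalPhysics.QuantumFieldTheory.Balaban1983to89.T4EtaRateCoeffDefect (pull pull_apply)
open Summit.QuantumFields.YangMills.BalabanUVNodes.N15.BackgroundLayer (fgrad fgradAdj bgrad fgrad_apply fgradAdj_apply bgrad_apply)
open Summit.QuantumFields.YangMills.BalabanUVNodes.N15.Gluing (lapDir lapOp)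

variable {X X' : Type} [DecidableEq X] [DecidableEq X']
variable (W : Finset X) (e : X → X') (T : Module.End ℝ (X' → ℝ))

/-! ## §1 Behind a cut supported one step inside the window, global shifts ∕ `∇*∇` ∕ `Δ_a` agree with the transplanted cube ones -/

section Cut

/-- THE ATOMIC CUT-SHIFT IDENTITY: for a global shift `E` and a cube shift `E′` with `e (E x) = E′ (e x)` whenever `x, Ex ∈ W`, and `h = 0` on `{x ∉ W} ∪ {Ex ∉ W}`:
`M_h ∘ S_E ∘ (ε T ρ) = M_h ∘ ε (S_{E′} ∘ T) ρ` (EXACT). [cite: Balaban1984PropagatorsII, p.238 (T_□), (2.133) p.247 (shapes)] -/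
theorem mulOp_comp_pull_comp_transplant (E : X ≃ X) (E' : X' ≃ X') (hcompat : ∀ x ∈ W, E x ∈ W → e (E x) = E' (e x)) {h : X → ℝ}
    (hh : ∀ x, (x ∉ W ∨ E x ∉ W) → h x = 0) :
    mulOp h ∘ₗ pull E ∘ₗ transplant W e T = mulOp h ∘ₗ transplant W e (pull E' ∘ₗ T) := by
  refine LinearMap.ext fun f => funext fun x => ?_
  simp only [LinearMap.comp_apply, mulOp_apply, pull_apply, transplant_apply]
  by_cases hx : x ∈ W
  · by_cases hEx : E x ∈ W
    · rw [if_pos hEx, if_pos hx, hcompat x hx hEx]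
    · rw [hh x (Or.inr hEx), zero_mul, zero_mul]
  · rw [hh x (Or.inl hx), zero_mul, zero_mul]

/-- A GLOBAL MULTIPLICATION PAST THE TRANSPLANT IS THE TRANSPLANT OF THE CUBE MULTIPLICATION: `a = a′ ∘ e` on `W` ⟹ `M_a ∘ εTρ = ε(M_{a′} ∘ T)ρ` (EXACT; the zeroth-order parts
`Q*aQ`, mass, curvature of `Δ_a` read through the chart). [cite: Balaban1984PropagatorsII, (2.90)–(2.91) p.239 (shape)] -/
theorem mulOp_comp_transplant_comm {a : X → ℝ} {a' : X' → ℝ} (ha : ∀ x ∈ W, a x = a' (e x)) :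
    mulOp a ∘ₗ transplant W e T = transplant W e (mulOp a' ∘ₗ T) := by
  refine LinearMap.ext fun f => funext fun x => ?_
  simp only [LinearMap.comp_apply, mulOp_apply, transplant_apply]
  by_cases hx : x ∈ W
  · rw [if_pos hx, if_pos hx, ha x hx]
  · rw [if_neg hx, if_neg hx, mul_zero]

/-- ★★ **`∇*∇` PAST THE TRANSPLANT BEHIND A CUT**: `h = 0` on `{x ∉ W} ∪ {Ex ∉ W} ∪ {E⁻¹x ∉ W}` ⟹ `M_h ∘ ∇*_E∇_E ∘ (εTρ) = M_h ∘ ε(∇*_{E′}∇_{E′} ∘ T)ρ` (EXACT; `∇*∇ = Gluing.lapDir`: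
`n²(2f(x) − f(Ex) − f(E⁻¹x))`). [cite: Balaban1984PropagatorsII, p.239 («Using the formulas (1.126)–(1.128)»), (2.133) p.247 (shapes)] -/
theorem mulOp_comp_lapDir_comp_transplant (E : X ≃ X) (E' : X' ≃ X') (n : ℝ) (hcompat : ∀ x ∈ W, E x ∈ W → e (E x) = E' (e x)) {h : X → ℝ}
    (hh : ∀ x, (x ∉ W ∨ E x ∉ W ∨ E.symm x ∉ W) → h x = 0) :
    mulOp h ∘ₗ lapDir n E ∘ₗ transplant W e T = mulOp h ∘ₗ transplant W e (lapDir n E' ∘ₗ T) := by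
  refine LinearMap.ext fun f => funext fun x => ?_
  simp only [lapDir, LinearMap.comp_apply, mulOp_apply, fgradAdj_apply, fgrad_apply, transplant_apply, Equiv.apply_symm_apply]
  by_cases hx : x ∈ W
  · by_cases hEx : E x ∈ W
    · by_cases hEix : E.symm x ∈ W
      · have hc : e x = E' (e (E.symm x)) := by
          have h1 := hcompat (E.symm x) hEix (by rwa [Equiv.apply_symm_apply]); rwa [Equiv.apply_symm_apply] at h1
        have hc' : E'.symm (e x) = e (E.symm x) := by rw [hc, Equiv.symm_apply_apply]
        rw [if_pos hx, if_pos hEx, if_pos hEix, if_pos hx, hcompat x hx hEx, hc']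
      · rw [hh x (Or.inr (Or.inr hEix)), zero_mul, zero_mul]
    · rw [hh x (Or.inr (Or.inl hEx)), zero_mul, zero_mul]
  · rw [hh x (Or.inl hx), zero_mul, zero_mul]

variable {J : Type} [Fintype J]

/-- `B ∘ (Σ_μ A_μ) ∘ C = Σ_μ B ∘ A_μ ∘ C` (finite sums of linear operators). [folklore] -/
theorem comp_fsum_comp {F₁ F₂ F₃ F₄ : Type} [AddCommGroup F₁] [Module ℝ F₁] [AddCommGroup F₂] [Module ℝ F₂] [AddCommGroup F₃] [Module ℝ F₃] [AddCommGroup F₄] [Module ℝ F₄]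
    (B : F₃ →ₗ[ℝ] F₄) (A : J → F₂ →ₗ[ℝ] F₃) (C : F₁ →ₗ[ℝ] F₂) : B ∘ₗ (∑ μ, A μ) ∘ₗ C = ∑ μ, B ∘ₗ A μ ∘ₗ C := by
  refine LinearMap.ext fun v => ?_
  simp only [LinearMap.comp_apply, LinearMap.sum_apply, map_sum]

/-- The transplant is additive in the cube operator. [folklore] -/
theorem transplant_add (S₁ S₂ : Module.End ℝ (X' → ℝ)) : transplant W e (S₁ + S₂) = transplant W e S₁ + transplant W e S₂ := by
  simp only [transplant, LinearMap.add_comp, LinearMap.comp_add]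

/-- … and over finite sums. [folklore] -/
theorem transplant_fsum (S : J → Module.End ℝ (X' → ℝ)) : transplant W e (∑ μ, S μ) = ∑ μ, transplant W e (S μ) := by
  simp only [transplant]
  exact comp_fsum_comp (extendOp W e) S (restrictOp W e)

/-- ★★ **A LAPLACIAN-TYPE OPERATOR PAST THE TRANSPLANT BEHIND A CUT.**  Directions `μ : J` with global shifts `E μ` and cube shifts `E′ μ`, compatible through the chart inside the
window; `h = 0` on the one-step layer in every direction (`x ∉ W ∨ E_μx ∉ W ∨ E_μ⁻¹x ∉ W ⟹ h x = 0`); zeroth-order parts compatible behind the cut (`M_h ∘ W_glob ∘ εTρ =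
M_h ∘ ε(W_□ ∘ T)ρ`).  Then `M_h ∘ Δ_glob ∘ (εTρ) = M_h ∘ ε(Δ_□ ∘ T)ρ`, `Δ = Gluing.lapOp n E W_glob`, `Δ_□ = Gluing.lapOp n E′ W_□` (EXACT). [cite: Balaban1985BackgroundPropagators, (3.26) p.395 (Δ_a: shape); Balaban1984PropagatorsII, (2.90)–(2.91) p.239, (2.133) p.247 (shapes)] -/
theorem mulOp_comp_lapOp_comp_transplant (E : J → X ≃ X) (E' : J → X' ≃ X') (n : ℝ) (Wg : (X → ℝ) →ₗ[ℝ] (X → ℝ)) (Wc : (X' → ℝ) →ₗ[ℝ] (X' → ℝ))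
    (hcompat : ∀ μ, ∀ x ∈ W, E μ x ∈ W → e (E μ x) = E' μ (e x)) {h : X → ℝ} (hh : ∀ μ x, (x ∉ W ∨ E μ x ∉ W ∨ (E μ).symm x ∉ W) → h x = 0)
    (hW : mulOp h ∘ₗ Wg ∘ₗ transplant W e T = mulOp h ∘ₗ transplant W e (Wc ∘ₗ T)) :
    mulOp h ∘ₗ lapOp n E Wg ∘ₗ transplant W e T = mulOp h ∘ₗ transplant W e (lapOp n E' Wc ∘ₗ T) := by
  have hμ : ∀ μ, mulOp h ∘ₗ lapDir n (E μ) ∘ₗ transplant W e T = mulOp h ∘ₗ transplant W e (lapDir n (E' μ) ∘ₗ T) :=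
    fun μ => mulOp_comp_lapDir_comp_transplant W e T (E μ) (E' μ) n (hcompat μ) (hh μ)
  have h1 : mulOp h ∘ₗ (∑ μ, lapDir n (E μ)) ∘ₗ transplant W e T = mulOp h ∘ₗ transplant W e ((∑ μ, lapDir n (E' μ)) ∘ₗ T) := by
    rw [comp_fsum_comp]
    have hs : (∑ μ, lapDir n (E' μ)) ∘ₗ T = ∑ μ, lapDir n (E' μ) ∘ₗ T := LinearMap.ext fun v => by simp only [LinearMap.comp_apply, LinearMap.sum_apply]
    have hc : mulOp h ∘ₗ (∑ μ, transplant W e (lapDir n (E' μ) ∘ₗ T)) = ∑ μ, mulOp h ∘ₗ transplant W e (lapDir n (E' μ) ∘ₗ T) :=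
      LinearMap.ext fun v => by simp only [LinearMap.comp_apply, LinearMap.sum_apply, map_sum]
    rw [hs, transplant_fsum, hc]
    exact Finset.sum_congr rfl fun μ _ => hμ μ
  simp only [lapOp, LinearMap.add_comp, LinearMap.comp_add, transplant_add, h1, hW]

end Cut

/-! ## §2 The cube's localized-inverse property transplants to the global lattice behind the cut -/

section Hloc

/-- ★★ **THE SANDWICH `M_h ∘ ε S ρ = M_h` FROM THE CUBE IDENTITY `M_χ′ ∘ S = M_χ′`.**  Chart injective on `W`, `h = 0` off `W`, and `h x ≠ 0 ⟹ χ′(e x) = 1` (the cut lives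
where the cube's `χ′`, read through the chart, equals one).  Then any cube operator `S` with `M_χ′ ∘ S = M_χ′` satisfies `M_h ∘ (ε S ρ) = M_h` on the global lattice (EXACT; `ρ ∘`-round trip
by `restrictOp_apply_of_injOn`). [cite: Balaban1984PropagatorsII, (2.90)–(2.93) p.239, p.238 (T_□) (shapes)] -/
theorem mulOp_comp_transplant_eq_mulOp_of_cut (hinj : Set.InjOn e ↑W) {S : Module.End ℝ (X' → ℝ)} {χ' : X' → ℝ} (hS : ∀ g x', χ' x' = 1 → S g x' = g x')
    {h : X → ℝ} (hh0 : ∀ x, x ∉ W → h x = 0) (hhχ : ∀ x, h x ≠ 0 → χ' (e x) = 1) :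
    mulOp h ∘ₗ transplant W e S = mulOp h := by
  refine LinearMap.ext fun f => funext fun x => ?_
  rw [LinearMap.comp_apply, mulOp_apply, mulOp_apply, transplant_apply]
  by_cases hx : x ∈ W
  · rw [if_pos hx]
    by_cases hhx : h x = 0
    · rw [hhx, zero_mul, zero_mul]
    · rw [hS _ _ (hhχ x hhx), restrictOp_apply_of_injOn hinj f hx]
  · rw [hh0 x hx, zero_mul, zero_mul]

omit [DecidableEq X'] in
/-- From the operator identity `M_χ′ ∘ S = M_χ′` to its pointwise form where `χ′ = 1`. [folklore] -/
theorem apply_eq_of_mulOp_comp_eq {S : Module.End ℝ (X' → ℝ)} {χ' : X' → ℝ} (hS : mulOp χ' ∘ₗ S = mulOp χ') (g : X' → ℝ) (x' : X') (hx' : χ' x' = 1) :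
    S g x' = g x' := by
  have h1 := congrArg (fun L : Module.End ℝ (X' → ℝ) => L g x') hS
  simpa only [LinearMap.comp_apply, mulOp_apply, hx', one_mul] using h1

variable {J : Type} [Fintype J]

/-- ★★★ **THE TRANSPLANTED `hloc`.**  A cube operator `G` on the cube's own lattice with the localized-inverse property `M_χ′ ∘ Δ_□ ∘ G = M_χ′` (`Δ_□ = Gluing.lapOp n E′ W_□`);
a window `W` with chart `e` injective on it, global∕cube shifts compatible inside the window, zeroth-order parts compatible behind the cut; a cut `h` vanishing on the one-step layer
in every direction and living inside `{χ′ ∘ e = 1}`.  Then ON THE GLOBAL LATTICE `M_h ∘ Δ_glob ∘ (ε G ρ) = M_h` — EXACT, no boundary letter: the per-cube input `hloc` of the gluing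
(dag-n15-a FILE 45 ∕ N-IIIa, dag-n15-w3 `mulOp_comp_covLapM_add_comp_dressed`) for a cube operator TYPED ON ITS OWN TORUS and transplanted by file 11.
[cite: Balaban1984PropagatorsII, (2.90)–(2.93) p.239, (2.36) p.229, p.238 (T_□) (shapes, mechanism); Balaban1985BackgroundPropagators, (3.26) p.395 (Δ_a: shape)] -/
theorem mulOp_comp_lapOp_comp_transplant_of_hloc (hinj : Set.InjOn e ↑W) (E : J → X ≃ X) (E' : J → X' ≃ X') (n : ℝ)
    (Wg : (X → ℝ) →ₗ[ℝ] (X → ℝ)) (Wc : (X' → ℝ) →ₗ[ℝ] (X' → ℝ)) {G : Module.End ℝ (X' → ℝ)} {χ' : X' → ℝ}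
    (hloc : mulOp χ' ∘ₗ lapOp n E' Wc ∘ₗ G = mulOp χ')
    (hcompat : ∀ μ, ∀ x ∈ W, E μ x ∈ W → e (E μ x) = E' μ (e x)) {h : X → ℝ} (hh : ∀ μ x, (x ∉ W ∨ E μ x ∉ W ∨ (E μ).symm x ∉ W) → h x = 0)
    (hh0 : ∀ x, x ∉ W → h x = 0) (hhχ : ∀ x, h x ≠ 0 → χ' (e x) = 1)
    (hW : mulOp h ∘ₗ Wg ∘ₗ transplant W e G = mulOp h ∘ₗ transplant W e (Wc ∘ₗ G)) :
    mulOp h ∘ₗ lapOp n E Wg ∘ₗ transplant W e G = mulOp h := by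
  rw [mulOp_comp_lapOp_comp_transplant W e G E E' n Wg Wc hcompat hh hW]
  have hloc' : mulOp χ' ∘ₗ (lapOp n E' Wc ∘ₗ G) = mulOp χ' := by rw [← LinearMap.comp_assoc]; exact hloc
  exact mulOp_comp_transplant_eq_mulOp_of_cut W e hinj (apply_eq_of_mulOp_comp_eq hloc') hh0 hhχ

/-- ★★ **THE TRANSPLANTED `hloc` WITH A CUBE-SIDE DEFECT SLOT**: `M_χ′ ∘ Δ_□ ∘ G = M_χ′ + D` on the cube ⟹ `M_h ∘ Δ_glob ∘ (εGρ) = M_h + M_h ∘ (εDρ)` on the global lattice (same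
cut hypotheses; `D` = e.g. the nonlocal tail `−M_χ′ N M_{1−χ} G` of dag-n15-w3's `mulOp_comp_comp_sandwich_of_hloc`; its global letter is file 11's `hasMaj_transplant`).
[cite: Balaban1984PropagatorsII, (2.90)–(2.93) p.239 (shape)] -/
theorem mulOp_comp_lapOp_comp_transplant_of_hloc_defect (hinj : Set.InjOn e ↑W) (E : J → X ≃ X) (E' : J → X' ≃ X') (n : ℝ)
    (Wg : (X → ℝ) →ₗ[ℝ] (X → ℝ)) (Wc : (X' → ℝ) →ₗ[ℝ] (X' → ℝ)) {G D : Module.End ℝ (X' → ℝ)} {χ' : X' → ℝ}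
    (hloc : mulOp χ' ∘ₗ lapOp n E' Wc ∘ₗ G = mulOp χ' + D)
    (hcompat : ∀ μ, ∀ x ∈ W, E μ x ∈ W → e (E μ x) = E' μ (e x)) {h : X → ℝ} (hh : ∀ μ x, (x ∉ W ∨ E μ x ∉ W ∨ (E μ).symm x ∉ W) → h x = 0)
    (hh0 : ∀ x, x ∉ W → h x = 0) (hhχ : ∀ x, h x ≠ 0 → χ' (e x) = 1)
    (hW : mulOp h ∘ₗ Wg ∘ₗ transplant W e G = mulOp h ∘ₗ transplant W e (Wc ∘ₗ G)) :
    mulOp h ∘ₗ lapOp n E Wg ∘ₗ transplant W e G = mulOp h + mulOp h ∘ₗ transplant W e D := by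
  rw [mulOp_comp_lapOp_comp_transplant W e G E E' n Wg Wc hcompat hh hW]
  -- behind the cut the transplant of `Δ_□ G` is the transplant of `M_χ′ Δ_□ G = M_χ′ + D`
  have hcutL : mulOp h ∘ₗ transplant W e (lapOp n E' Wc ∘ₗ G) = mulOp h ∘ₗ transplant W e (mulOp χ' ∘ₗ lapOp n E' Wc ∘ₗ G) := by
    refine LinearMap.ext fun f => funext fun x => ?_
    simp only [LinearMap.comp_apply, mulOp_apply, transplant_apply]
    by_cases hx : x ∈ W
    · rw [if_pos hx, if_pos hx]
      by_cases hhx : h x = 0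
      · rw [hhx, zero_mul, zero_mul]
      · rw [hhχ x hhx, one_mul]
    · rw [if_neg hx, if_neg hx]
  have hloc' : mulOp χ' ∘ₗ (lapOp n E' Wc ∘ₗ G) = mulOp χ' + D := by rw [← LinearMap.comp_assoc]; exact hloc
  rw [hcutL, hloc', transplant_add, LinearMap.comp_add,
    mulOp_comp_transplant_eq_mulOp_of_cut W e hinj (S := mulOp χ') (χ' := χ') (fun g x' hx' => by simp only [mulOp_apply, hx', one_mul]) hh0 hhχ]

/-- ★ **THE DEFECT SLOT's LETTER ON THE GLOBAL LATTICE**: if the cube-side defect `D` has the cube majorant `K ≥ 0` (chart injective on the window, blocks preserved) and `|h| ≤ 1`,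
then `M_h ∘ (εDρ) ≤ 1_W(y)·1_W(y′)·K(y, y′)` — file 11's (2.133) shape behind the cut; with `h` supported in the blocks of `H ⊆ W` the consumer reads `1_H(y)·K` (dag-n15-w3's
`E ≤ 1_H(y)·m_E·e^{−δd}` slot). [cite: Balaban1984PropagatorsII, (2.133) p.247, (2.90)–(2.93) p.239 (shapes)] -/
theorem hasMaj_mulOp_comp_transplant {g : B6.Geometry} [Fintype X] [Fintype X'] (blk : X → g.Site) (blk' : X' → g.Site) (hinj : Set.InjOn e ↑W)
    (hblk : ∀ x ∈ W, blk' (e x) = blk x) {D : Module.End ℝ (X' → ℝ)} {K : g.Site → g.Site → ℝ} (hK : ∀ a b, 0 ≤ K a b)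
    (hD : HasMaj (BlockNorm.ofBlocks g blk') (BlockNorm.ofBlocks g blk') D K) {h : X → ℝ} (hh1 : ∀ x, |h x| ≤ 1) :
    HasMaj (BlockNorm.ofBlocks g blk) (BlockNorm.ofBlocks g blk) (mulOp h ∘ₗ transplant W e D) (fun y y' => windowInd W blk y * windowInd W blk y' * K y y') := by
  have hT := hasMaj_transplant W e blk blk' hinj hblk hK hD
  intro y' μ hμ y
  have h0 : 0 ≤ windowInd W blk y * windowInd W blk y' * K y y' := mul_nonneg (mul_nonneg (windowInd_nonneg _ _ _) (windowInd_nonneg _ _ _)) (hK y y')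
  refine loc_ofBlocks_le blk _ (mul_nonneg h0 ((BlockNorm.ofBlocks g blk).loc_nonneg y' μ)) fun x hx => ?_
  rw [LinearMap.comp_apply, mulOp_apply, abs_mul]
  exact (mul_le_of_le_one_left (abs_nonneg _) (hh1 x)).trans ((abs_le_loc_ofBlocks blk _ hx).trans (hT y' μ hμ y))

end Hloc

end Summit.QuantumFields.YangMills.BalabanUVNodes.N15.CurvedSpecies

end
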